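import Literature.AlgebraicGeometry.Motives.ThickeningLevelsComplex
import HarnessLib

/-!
# The levels `𝒪_{T,t}/𝔪^{n+1}` over `ℂ`: every `ℂ`-algebra map to `ℂ` is the augmentation `ρ n`

Generic companion of `Motives/ThickeningLevelsComplex` (the levels `Rt T′ t n = 𝒪_{T,t}/𝔪^{n+1}` of a complex scheme `T′` at a
closed point `t`, with augmentation `ρℂ T′ t ht n : Rt T′ t n →ₐ[ℂ] ℂ` through `κ(t) = ℂ`):

* `ρℂ_mk_eq_zero_iff` — `ρ n` kills exactly the residue classes of `𝔪_t`;
* `isNilpotent_of_ρℂ_eq_zero` — an element killed by `ρ n` is nilpotent (`𝔪^{n+1} = 0` in the level);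
* `algHom_eq_ρℂ` — EVERY `ℂ`-algebra map `𝒪_{T,t}/𝔪^{n+1} → ℂ` is `ρ n` (`𝒪/𝔪^{n+1} = ℂ ⊕ 𝔪/𝔪^{n+1}` with nil second
  summand, and `ℂ` is reduced) — i.e. the Artinian level has exactly one `ℂ`-point ([GortzWedhorn2023] Lemma 24.72;
  [MumfordAV1970] §13, the local Artinian `ℂ`-algebras through a point).

Consumer: cell hodgecm-mathlib, M13 node N3 (γ8: uniqueness of the `ℂ`-point of `Â` through `y₀`; γ6/E0 at `n = 0`).
Author B-p07 (g12).  HC_CM is proved only modulo the 7 printed citations until rung 0 closes.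

## References
* [GortzWedhorn2023] U. Görtz, T. Wedhorn, *Algebraic Geometry II* (2023), Lemma 24.72 (p. 409) and its proof, Step (I).
* [MumfordAV1970] D. Mumford, *Abelian Varieties* (1970), §13 (proof of the Thm. pp. 125–130).
-/

noncomputable section

open CategoryTheory AlgebraicGeometry IsLocalRing

namespace Literature.AlgebraicGeometry.Motives.AbelianVariety

section LevelsAug

variable (T' : SchemeOver ℂ) (t : T'.left) [LocallyOfFiniteType T'.hom] (ht : IsClosed ({t} : Set T'.left))


/-- The augmentation `ρ n` kills exactly the residue classes of `𝔪_t`. [cite: GortzWedhorn2023, Lemma 24.72 (p. 409)] -/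
theorem ρℂ_mk_eq_zero_iff (n : ℕ) (r : stalkAt T' (topPt T' t)) :
    ρℂ T' t ht n (Ideal.Quotient.mk _ r) = 0 ↔ r ∈ maximalIdeal (stalkAt T' (topPt T' t)) := by
  rw [ρℂ_apply, ← thickρ_eq_zero_iff T' (topPt T' t) n r]
  constructor
  · intro h
    exact κhom_injective T' t ht (by rw [h, map_zero])
  · intro h
    rw [h, map_zero]

/-- An element of `𝒪/𝔪^{n+1}` killed by `ρ n` is nilpotent. [cite: GortzWedhorn2023, Lemma 24.72 (p. 409)] -/
theorem isNilpotent_of_ρℂ_eq_zero (n : ℕ) (r : Rt T' t n) (hr : ρℂ T' t ht n r = 0) : IsNilpotent r := by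
  obtain ⟨r, rfl⟩ := Ideal.Quotient.mk_surjective r
  refine ⟨n + 1, ?_⟩
  rw [← map_pow, Ideal.Quotient.eq_zero_iff_mem]
  exact Ideal.pow_mem_pow ((ρℂ_mk_eq_zero_iff T' t ht n r).1 hr) _

/-- **Every `ℂ`-algebra map `𝒪_{T,t}/𝔪^{n+1} → ℂ` is the augmentation `ρ n`** (`𝒪/𝔪^{n+1} = ℂ ⊕ 𝔪/𝔪^{n+1}` with
`𝔪/𝔪^{n+1}` nil, and `ℂ` is reduced). [cite: GortzWedhorn2023, Lemma 24.72 (p. 409)] [cite: MumfordAV1970, §13 (proof of the Thm. pp. 125–130)] -/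
theorem algHom_eq_ρℂ (n : ℕ) (ψ : Rt T' t n →ₐ[ℂ] ℂ) : ψ = ρℂ T' t ht n := by
  apply AlgHom.ext
  intro r
  have h0 : ρℂ T' t ht n (r - algebraMap ℂ (Rt T' t n) (ρℂ T' t ht n r)) = 0 := by
    rw [map_sub, AlgHom.commutes, Algebra.algebraMap_self_apply, sub_self]
  have hnil : IsNilpotent (ψ (r - algebraMap ℂ (Rt T' t n) (ρℂ T' t ht n r))) :=
    (isNilpotent_of_ρℂ_eq_zero T' t ht n _ h0).map ψ
  have hz : ψ (r - algebraMap ℂ (Rt T' t n) (ρℂ T' t ht n r)) = 0 := hnil.eq_zero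
  rw [map_sub, AlgHom.commutes, Algebra.algebraMap_self_apply, sub_eq_zero] at hz
  exact hz

end LevelsAug

end Literature.AlgebraicGeometry.Motives.AbelianVariety

end
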